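import Mathlib
import Literature.Computability.AlgebraicComplexity.NewtonPolygonTauBounds
import Summits.ValiantsHypothesis.ValiantsHypothesis.Theorems.NewtonUnitEquationsTwoProductsFormalLogLinearisationLiftedBox
import Summits.ValiantsHypothesis.ValiantsHypothesis.Theorems.NewtonUnitEquationsTwoProductsFormalLogLinearisationLiftedHyperbolicCross
import HarnessLib

/-!
# Route NewtonUnitEquations — crux `TwoProducts` (stmt-ValiantsHypothesis-5906), line `formal-log-linearisation`:
# the LIFTED PENCIL COUNT is polynomial in `s` for `m ≤ 3` (via Eisenbrand–Pach–Rothvoß–Sopher)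

THEORY lane of the line's OPEN engine `stub_logSumEngine` (memo `memo-logSumEngine-core.md` of val-width-0318-p2,
evidence n°45–49 on the crux item; tree files `…FormalLogLinearisationLifted{Box,HyperbolicCross,OnePair,TwoMonomials}.lean`).
In the memo's LIFTED currency — two `m`-point configurations `A, B ⊂ ℂ^s`, the unequal-moment function
`G(μ) = Σ_j A_j^μ − Σ_j B_j^μ`, a 2-pencil of strictly positive gradings `θ₁ + c θ₂`, and the PENCIL-VISIBILITY clause
(verbatim the hypothesis of `unequalMoment_pencilVisible_hyperbolicCross`: `G(μ) ≠ 0` and `μ` is the strict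
`(θ₁ + c θ₂)`-minimiser of `{G ≠ 0}` for some `c > 0`) — the memo's `LiftedPencilCount` asks for a bound
`2^(a m)·(s+2)^b` on pencil-visible sets; its "first open value" (v4) is a POLYNOMIAL-in-`s` bound at `m = 2`.
This file settles `m ≤ 3` with exponent `4/3`:

* `convexIndependent_pencilImage` — the planar image `Π(μ) = (Σ_i θ₂(i) μ_i, Σ_i θ₁(i) μ_i)` of a pencil-visible set
  is injective and CONVEXLY INDEPENDENT: the visibility clause says exactly that `Π(μ)` is the strict minimiser of
  the linear functional `y ↦ y₁ + c_μ y₀` over the image;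
* `liftedPencilCount_supportTwo` (all `m`) — pencil-visible multi-indices supported on `≤ 2` coordinates number
  `≤ 16·(N^{2/3}·N^{2/3} + 2N)`, `N = 2ms + 1`: by the box lemma (`μ_i < 2m`, `unequalMoment_pencilVisible_lt`)
  their images lie in `Q + Q`, `Q = {0} ∪ {k·P_i : i < s, k < 2m}`, `P_i = (θ₂ i, θ₁ i)`, and a convexly
  independent subset of a planar Minkowski sum `Q + Q` has `≤ 16(|Q|^{4/3} + 2|Q|)` points — the tree's
  EISENBRAND–PACH–ROTHVOSS–SOPHER bound `KPTT.EPRS.card_le_of_convexIndependent_subset_add` (= KPTT 2015 Thm 4, the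
  very tool of the `τ`-conjecture paper);
* `liftedPencilCount_le_three` (`m ≤ 3`) — by the hyperbolic cross (`∏(μ_i+1) ≤ 2m ≤ 6 < 8`,
  `unequalMoment_pencilVisible_card_support_le`) EVERY pencil-visible `μ` has `|supp μ| ≤ 2`, so the whole
  pencil-visible count is `O(s^{4/3})` — polynomial in `s` for `m = 2, 3` (the memo conjectures `O(s)`, which stays
  open; for `m ≥ 4` support-3 points appear and the count stays quasi-polynomial `2m·s^{log₂ 2m}`).

Honest framing: a calibration lemma for the THEORY lane of an OPEN engine; `LiftedPencilCount` is only NECESSARY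
for the engine (memo §2), the engine `stub_logSumEngine` and the crux `TwoProducts` stay OPEN, the line is not
the item's skeleton of record, and nothing here is progress on `VP ≠ VNP` (NOT proved). No definitions, no named
facts.
-/

noncomputable section

-- Sub = Summit single-conjunct layout: the duplicated namespace component is mandated by the tree.
set_option linter.dupNamespace false

namespace Summit.ValiantsHypothesis.ValiantsHypothesis.Theorems.NewtonUnitEquations.TwoProducts.FormalLogLinearisation

open scoped BigOperators Pointwise
open Literature.Computability.AlgebraicComplexity

variable {m s : ℕ}

/-! ### The planar image of the pencil -/

/-- The pencil weight is a planar pairing: `Σ_i (θ₁ i + c θ₂ i) μ_i = Π(μ)₁ + c · Π(μ)₀` with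
`Π(μ) = (Σ θ₂ μ, Σ θ₁ μ)`. [folklore] -/
theorem pencilWeight_eq (θ₁ θ₂ : Fin s → ℝ) (c : ℝ) (μ : Fin s → ℕ) :
    ∑ i, (θ₁ i + c * θ₂ i) * (μ i : ℝ) =
      (![∑ i, θ₂ i * (μ i : ℝ), ∑ i, θ₁ i * (μ i : ℝ)] : Fin 2 → ℝ) 1 +
        c * (![∑ i, θ₂ i * (μ i : ℝ), ∑ i, θ₁ i * (μ i : ℝ)] : Fin 2 → ℝ) 0 := by
  simp only [Matrix.cons_val_zero, Matrix.cons_val_one, Matrix.cons_val_fin_one]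
  rw [Finset.mul_sum, ← Finset.sum_add_distrib]
  exact Finset.sum_congr rfl fun i _ => by ring

/-- **The planar image of a pencil-visible set is injective and convexly independent.** If every `μ ∈ S` is the
strict minimiser of the pencil weight `θ₁ + c_μ θ₂` over `S` for some `c_μ`, then `Π` is injective on `S` and
`Π(S) ⊂ ℝ²` is convexly independent (each `Π(μ)` is a strictly exposed point of the image, for the linear
functional `y ↦ y₁ + c_μ y₀`). [folklore] -/
theorem convexIndependent_pencilImage (θ₁ θ₂ : Fin s → ℝ) (S : Finset (Fin s → ℕ))
    (hS : ∀ μ ∈ S, ∃ c : ℝ, ∀ ν ∈ S, ν ≠ μ →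
      ∑ i, (θ₁ i + c * θ₂ i) * (μ i : ℝ) < ∑ i, (θ₁ i + c * θ₂ i) * (ν i : ℝ)) :
    Set.InjOn (fun μ : Fin s → ℕ => (![∑ i, θ₂ i * (μ i : ℝ), ∑ i, θ₁ i * (μ i : ℝ)] : Fin 2 → ℝ)) ↑S ∧
      ConvexIndependent ℝ (Subtype.val :
        ↥((S.image fun μ : Fin s → ℕ => (![∑ i, θ₂ i * (μ i : ℝ), ∑ i, θ₁ i * (μ i : ℝ)] : Fin 2 → ℝ)) :
          Set (Fin 2 → ℝ)) → (Fin 2 → ℝ)) := by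
  classical
  set pim : (Fin s → ℕ) → (Fin 2 → ℝ) := fun μ => ![∑ i, θ₂ i * (μ i : ℝ), ∑ i, θ₁ i * (μ i : ℝ)] with hpim
  -- the weight in planar terms
  have hw : ∀ (c : ℝ) (μ : Fin s → ℕ), ∑ i, (θ₁ i + c * θ₂ i) * (μ i : ℝ) = pim μ 1 + c * pim μ 0 :=
    fun c μ => pencilWeight_eq θ₁ θ₂ c μ
  have hinj : Set.InjOn pim ↑S := by
    intro μ hμ μ' hμ' hEq
    by_contra hne
    obtain ⟨c, hc⟩ := hS μ (Finset.mem_coe.1 hμ)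
    have hlt := hc μ' (Finset.mem_coe.1 hμ') (Ne.symm hne)
    rw [hw, hw, hEq] at hlt
    exact lt_irrefl _ hlt
  refine ⟨hinj, ?_⟩
  rw [convexIndependent_set_iff_notMem_convexHull_sdiff]
  intro x hx hxconv
  obtain ⟨μ, hμ, rfl⟩ := Finset.mem_image.1 (Finset.mem_coe.1 hx)
  obtain ⟨c, hc⟩ := hS μ hμ
  -- the open half-plane `{y | Π μ 1 + c Π μ 0 < y 1 + c y 0}` is convex, contains the other image points, not `Π μ`
  let f : (Fin 2 → ℝ) →ₗ[ℝ] ℝ := LinearMap.proj 1 + c • LinearMap.proj 0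
  have hf : ∀ y : Fin 2 → ℝ, f y = y 1 + c * y 0 := fun y => by
    simp [f, smul_eq_mul]
  have hconv : Convex ℝ {y : Fin 2 → ℝ | f (pim μ) < f y} := convex_halfSpace_gt f.isLinear _
  have hsub : (↑(S.image pim) : Set (Fin 2 → ℝ)) \ {pim μ} ⊆ {y : Fin 2 → ℝ | f (pim μ) < f y} := by
    rintro y ⟨hy, hyne⟩
    obtain ⟨ν, hν, rfl⟩ := Finset.mem_image.1 (Finset.mem_coe.1 hy)
    have hne : ν ≠ μ := fun h => hyne (by rw [h]; rfl)
    show f (pim μ) < f (pim ν)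
    rw [hf, hf, ← hw, ← hw]
    exact hc ν hν hne
  have hmem : pim μ ∈ {y : Fin 2 → ℝ | f (pim μ) < f y} := convexHull_min hsub hconv hxconv
  exact lt_irrefl _ (Set.mem_setOf_eq ▸ hmem)

/-! ### Multi-indices on at most two coordinates map into a planar Minkowski sum -/

/-- A multi-index supported on at most two coordinates, all `< K`, has planar image `Π(μ)` in `Q + Q` with
`Q = {0} ∪ {k · P_i : i < s, k < K}`, `P_i = (θ₂ i, θ₁ i)`. [folklore] -/
theorem pencilImage_mem_add (θ₁ θ₂ : Fin s → ℝ) (K : ℕ) (μ : Fin s → ℕ) (hK : ∀ i, μ i < K)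
    (hsupp : (Finset.univ.filter fun i => μ i ≠ 0).card ≤ 2) :
    (![∑ i, θ₂ i * (μ i : ℝ), ∑ i, θ₁ i * (μ i : ℝ)] : Fin 2 → ℝ) ∈
      insert (0 : Fin 2 → ℝ) ((Finset.univ ×ˢ Finset.range K).image
          fun p : Fin s × ℕ => (![θ₂ p.1 * (p.2 : ℝ), θ₁ p.1 * (p.2 : ℝ)] : Fin 2 → ℝ)) +
        insert (0 : Fin 2 → ℝ) ((Finset.univ ×ˢ Finset.range K).image
          fun p : Fin s × ℕ => (![θ₂ p.1 * (p.2 : ℝ), θ₁ p.1 * (p.2 : ℝ)] : Fin 2 → ℝ)) := by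
  classical
  set Q := insert (0 : Fin 2 → ℝ) ((Finset.univ ×ˢ Finset.range K).image
    fun p : Fin s × ℕ => (![θ₂ p.1 * (p.2 : ℝ), θ₁ p.1 * (p.2 : ℝ)] : Fin 2 → ℝ)) with hQ
  set T := Finset.univ.filter fun i => μ i ≠ 0 with hT
  -- the image is the sum over the support
  have hsum : (![∑ i, θ₂ i * (μ i : ℝ), ∑ i, θ₁ i * (μ i : ℝ)] : Fin 2 → ℝ) =
      ∑ i ∈ T, (![θ₂ i * (μ i : ℝ), θ₁ i * (μ i : ℝ)] : Fin 2 → ℝ) := by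
    have h0 : ∀ θ : Fin s → ℝ, ∑ i, θ i * (μ i : ℝ) = ∑ i ∈ T, θ i * (μ i : ℝ) := by
      intro θ
      rw [hT, Finset.sum_filter]
      refine Finset.sum_congr rfl fun i _ => ?_
      by_cases hi : μ i ≠ 0
      · rw [if_pos hi]
      · push Not at hi
        rw [if_neg (by simpa using hi), hi, Nat.cast_zero, mul_zero]
    ext k
    rw [Finset.sum_apply]
    fin_cases k
    · simp [h0 θ₂]
    · simp [h0 θ₁]
  have hmemQ : ∀ i, (![θ₂ i * (μ i : ℝ), θ₁ i * (μ i : ℝ)] : Fin 2 → ℝ) ∈ Q := by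
    intro i
    rw [hQ, Finset.mem_insert]
    exact Or.inr (Finset.mem_image.2 ⟨(i, μ i), Finset.mem_product.2 ⟨Finset.mem_univ _,
      Finset.mem_range.2 (hK i)⟩, rfl⟩)
  have h0Q : (0 : Fin 2 → ℝ) ∈ Q := by rw [hQ]; exact Finset.mem_insert_self _ _
  rw [hsum]
  -- at most two support points
  have hcard : T.card = 0 ∨ T.card = 1 ∨ T.card = 2 := by omega
  rcases hcard with h | h | h
  · rw [Finset.card_eq_zero.1 h, Finset.sum_empty]
    simpa using Finset.add_mem_add h0Q h0Q
  · obtain ⟨a, ha⟩ := Finset.card_eq_one.1 h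
    rw [ha, Finset.sum_singleton]
    simpa using Finset.add_mem_add (hmemQ a) h0Q
  · obtain ⟨a, b, hab, hab'⟩ := Finset.card_eq_two.1 h
    rw [hab', Finset.sum_pair hab]
    exact Finset.add_mem_add (hmemQ a) (hmemQ b)

/-- The size of `Q = {0} ∪ {k · P_i : i < s, k < K}` is at most `s K + 1`. [folklore] -/
theorem card_pencilDictionary_le (θ₁ θ₂ : Fin s → ℝ) (K : ℕ) :
    (insert (0 : Fin 2 → ℝ) ((Finset.univ ×ˢ Finset.range K).image
        fun p : Fin s × ℕ => (![θ₂ p.1 * (p.2 : ℝ), θ₁ p.1 * (p.2 : ℝ)] : Fin 2 → ℝ))).card ≤ s * K + 1 := by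
  classical
  refine (Finset.card_insert_le _ _).trans ?_
  refine Nat.add_le_add_right (Finset.card_image_le.trans ?_) 1
  rw [Finset.card_product, Finset.card_univ, Fintype.card_fin, Finset.card_range]

/-! ### The counts -/

/-- **Lifted pencil count on support `≤ 2` (all `m`): `O((ms)^{4/3})`.** In the memo's verbatim pencil-visibility
clause: pencil-visible unequal moments `μ` of two `m`-point configurations in `ℂ^s` that involve at most two
coordinates number at most `16·(N^{2/3}·N^{2/3} + N + N)` with `N = 2ms + 1` — their planar images form a convexly
independent subset of the Minkowski sum `Q + Q` (`|Q| ≤ N`, box lemma `μ_i < 2m`), bounded by the tree's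
Eisenbrand–Pach–Rothvoß–Sopher theorem. [folklore] -/
theorem liftedPencilCount_supportTwo (A B : Fin m → Fin s → ℂ) (θ₁ θ₂ : Fin s → ℝ)
    (hθ₁ : ∀ i, 0 < θ₁ i) (hθ₂ : ∀ i, 0 < θ₂ i) (S : Finset (Fin s → ℕ))
    (hS : ∀ μ ∈ S, (∑ j, ∏ i, A j i ^ μ i) ≠ (∑ j, ∏ i, B j i ^ μ i) ∧
      ∃ c : ℝ, 0 < c ∧ ∀ ν : Fin s → ℕ, ν ≠ μ →
        (∑ j, ∏ i, A j i ^ ν i) ≠ (∑ j, ∏ i, B j i ^ ν i) →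
          ∑ i, (θ₁ i + c * θ₂ i) * (μ i : ℝ) < ∑ i, (θ₁ i + c * θ₂ i) * (ν i : ℝ))
    (hsupp : ∀ μ ∈ S, (Finset.univ.filter fun i => μ i ≠ 0).card ≤ 2) :
    (S.card : ℝ) ≤ 16 * ((((2 * m * s + 1 : ℕ) : ℝ) ^ (2 / 3 : ℝ)) * (((2 * m * s + 1 : ℕ) : ℝ) ^ (2 / 3 : ℝ)) +
      ((2 * m * s + 1 : ℕ) : ℝ) + ((2 * m * s + 1 : ℕ) : ℝ)) := by
  classical
  set pim : (Fin s → ℕ) → (Fin 2 → ℝ) := fun μ => ![∑ i, θ₂ i * (μ i : ℝ), ∑ i, θ₁ i * (μ i : ℝ)] with hpim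
  set Q := insert (0 : Fin 2 → ℝ) ((Finset.univ ×ˢ Finset.range (2 * m)).image
    fun p : Fin s × ℕ => (![θ₂ p.1 * (p.2 : ℝ), θ₁ p.1 * (p.2 : ℝ)] : Fin 2 → ℝ)) with hQ
  -- injectivity and convex independence of the planar image
  have hvis : ∀ μ ∈ S, ∃ c : ℝ, ∀ ν ∈ S, ν ≠ μ →
      ∑ i, (θ₁ i + c * θ₂ i) * (μ i : ℝ) < ∑ i, (θ₁ i + c * θ₂ i) * (ν i : ℝ) := by
    intro μ hμ
    obtain ⟨-, c, -, hc⟩ := hS μ hμ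
    exact ⟨c, fun ν hν hne => hc ν hne (hS ν hν).1⟩
  obtain ⟨hinj, hci⟩ := convexIndependent_pencilImage θ₁ θ₂ S hvis
  -- the image lies in `Q + Q`
  have hsub : S.image pim ⊆ Q + Q := by
    intro x hx
    obtain ⟨μ, hμ, rfl⟩ := Finset.mem_image.1 hx
    exact pencilImage_mem_add θ₁ θ₂ (2 * m) μ
      (unequalMoment_pencilVisible_lt A B θ₁ θ₂ hθ₁ hθ₂ μ (hS μ hμ)) (hsupp μ hμ)
  have hE := KPTT.EPRS.card_le_of_convexIndependent_subset_add Q Q (S.image pim) hsub hci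
  rw [Finset.card_image_of_injOn hinj] at hE
  -- `|Q| ≤ 2ms + 1`
  have hQcard : (Q.card : ℝ) ≤ ((2 * m * s + 1 : ℕ) : ℝ) := by
    have h := card_pencilDictionary_le θ₁ θ₂ (2 * m) (s := s)
    have h' : s * (2 * m) + 1 = 2 * m * s + 1 := by ring
    rw [h'] at h
    exact_mod_cast h
  have hQ0 : (0 : ℝ) ≤ Q.card := Nat.cast_nonneg _
  have hpow : (Q.card : ℝ) ^ (2 / 3 : ℝ) ≤ ((2 * m * s + 1 : ℕ) : ℝ) ^ (2 / 3 : ℝ) :=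
    Real.rpow_le_rpow hQ0 hQcard (by norm_num)
  have hpow0 : (0 : ℝ) ≤ (Q.card : ℝ) ^ (2 / 3 : ℝ) := Real.rpow_nonneg hQ0 _
  refine hE.trans ?_
  gcongr

/-- **Lifted pencil count for `m ≤ 3`: polynomial in `s` (`O(s^{4/3})`).** For two configurations of at most three
points each (`m ≤ 3`), every pencil-visible unequal moment lies in the hyperbolic cross `∏(μ_i+1) ≤ 2m ≤ 6`, hence
involves at most two coordinates; so EVERY finite pencil-visible set has at most `16·(N^{2/3}·N^{2/3} + 2N)`
elements, `N = 2ms + 1 ≤ 6s + 1`. This settles the memo's "first open value" (polynomial-in-`s` at `m = 2`, also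
`m = 3`) with exponent `4/3`; `O(s)` (the memo's conjecture `(2m−1)(s−1)+1`) remains open. [folklore] -/
theorem liftedPencilCount_le_three (hm : m ≤ 3) (A B : Fin m → Fin s → ℂ) (θ₁ θ₂ : Fin s → ℝ)
    (hθ₁ : ∀ i, 0 < θ₁ i) (hθ₂ : ∀ i, 0 < θ₂ i) (S : Finset (Fin s → ℕ))
    (hS : ∀ μ ∈ S, (∑ j, ∏ i, A j i ^ μ i) ≠ (∑ j, ∏ i, B j i ^ μ i) ∧
      ∃ c : ℝ, 0 < c ∧ ∀ ν : Fin s → ℕ, ν ≠ μ →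
        (∑ j, ∏ i, A j i ^ ν i) ≠ (∑ j, ∏ i, B j i ^ ν i) →
          ∑ i, (θ₁ i + c * θ₂ i) * (μ i : ℝ) < ∑ i, (θ₁ i + c * θ₂ i) * (ν i : ℝ)) :
    (S.card : ℝ) ≤ 16 * ((((2 * m * s + 1 : ℕ) : ℝ) ^ (2 / 3 : ℝ)) * (((2 * m * s + 1 : ℕ) : ℝ) ^ (2 / 3 : ℝ)) +
      ((2 * m * s + 1 : ℕ) : ℝ) + ((2 * m * s + 1 : ℕ) : ℝ)) := by
  classical
  refine liftedPencilCount_supportTwo A B θ₁ θ₂ hθ₁ hθ₂ S hS fun μ hμ => ?_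
  have h := unequalMoment_pencilVisible_card_support_le A B θ₁ θ₂ μ (hS μ hμ)
  have hlog : Nat.log 2 (2 * m) ≤ 2 := by
    calc Nat.log 2 (2 * m) ≤ Nat.log 2 6 := Nat.log_mono_right (by omega)
      _ = 2 := by decide
  exact h.trans hlog

end Summit.ValiantsHypothesis.ValiantsHypothesis.Theorems.NewtonUnitEquations.TwoProducts.FormalLogLinearisation

end
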